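import Summits.BirchSwinnertonDyer.BirchSwinnertonDyer.Theorems.AdditiveKolyvaginRoadLevelKolyvaginSystemsAdditiveSplitCompletion
import Literature.NumberTheory.EllipticCurves.SemistableReductionBaseChange
import Literature.NumberTheory.EllipticCurves.ModularityVersionApProofs
import Literature.NumberTheory.EllipticCurves.GoodReductionUnramifiedProofs
import Literature.NumberTheory.EllipticCurves.HeegnerPoints
import Literature.NumberTheory.EllipticCurves.SelmerCorankControlRatProofs
import Literature.NumberTheory.DiophantineGeometry.LocalReduction
import HarnessLib

/-!
# Crux K1 `CumulativeHeegnerInclusionAtThree` (stmt-BirchSwinnertonDyer-24198), line `birth` — STUB F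
# `stub_badPlacesSplitFinite`: over a Heegner field, the bad places of `E_K` prime to `3` are finitely
# many and lie over rational primes split in `K`

Lead prover bsd-line-chl-k1-p1 g2 (`--supports stmt-BirchSwinnertonDyer-24198`). The `Σ` of
Castella–Grossi–Lee–Skinner §1.4 («a finite set of places of `K` containing the primes above `Np`, such
that the finite places in `Σ` are all split in `K`») for the Heegner field of the crux: a place `v` of `K`
at which the base change `E_K` has bad reduction lies over a rational prime `ℓ` of bad reduction of `E`
(semi-stable — in particular good — reduction is preserved under base change, Silverman VII.5.4 (b), tree
`isSemistableAt_baseChange_cases`), hence `ℓ ∣ N` (tree `dvd_conductorNorm_iff`), so there are finitely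
many such `v` (all contain `N`) and each `ℓ` splits in `K` by the Heegner hypothesis. Statement = stub F of
skeleton v4 of line `birth`, verbatim. THEOREMS ONLY; no definition, no `sorry`. BSD is not proved by any of this.
References: [SilvermanAEC2009] VII.5.4 (b); [DiamondShurman2005] §8.3; [GrossLMS1991] §1 (Heegner hypothesis).
-/

set_option autoImplicit false
-- `…BirchSwinnertonDyer.BirchSwinnertonDyer.Theorems…` is the problem's mandated namespace (D-0017).
set_option linter.dupNamespace false

noncomputable section

open scoped Classical

namespace Summit.BirchSwinnertonDyer.BirchSwinnertonDyer.Theorems.CumulativeHeegnerInclusionAtThreeBadPlaces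

open NumberField IsDedekindDomain WeierstrassCurve
open Literature.NumberTheory.EllipticCurves IsDedekindDomain.HeightOneSpectrum
  Summit.BirchSwinnertonDyer.BirchSwinnertonDyer.Theorems.AdditiveKoly.SplitCompletion

/-- **A bad place of the base change lies over a rational prime dividing the conductor.** For `E = W/ℚ`
and a number field `K`: if `W_K` has bad reduction at the place `v` of `K`, then the rational prime `ℓ`
below `v` divides `N(W)` — good reduction at `ℓ` would base-change to good reduction at `v` (Silverman
VII.5.4 (b)). [cite: SilvermanAEC2009, Prop. VII.5.4 (b)] [cite: DiamondShurman2005, §8.3 (p ∣ N ⟺ bad reduction)] -/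
theorem exists_prime_mem_dvd_conductorNorm_of_not_hasGoodReductionAt (W : WeierstrassCurve ℚ)
    [W.IsElliptic] (K : Type) [Field K] [NumberField K] (v : HeightOneSpectrum (𝓞 K))
    (hbad : ¬ (W.baseChange K).HasGoodReductionAt v) :
    ∃ ℓ : ℕ, ℓ.Prime ∧ ((ℓ : ℕ) : 𝓞 K) ∈ v.asIdeal ∧ ℓ ∣ W.conductorNorm ℤ := by
  set u : HeightOneSpectrum (𝓞 ℚ) := v.under (𝓞 ℚ) with hu
  haveI : v.asIdeal.LiesOver u.asIdeal := by
    rw [hu, HeightOneSpectrum.under_asIdeal]; infer_instance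
  have hbadQ : ¬ W.HasGoodReductionAt u := fun hg ↦ by
    rcases isSemistableAt_baseChange_cases K W (v := u) (w := v) hg.isSemistableAt with
      ⟨-, hK⟩ | ⟨hm, -⟩
    · exact hbad hK
    · exact hg.not_hasMultiplicativeReductionAt hm
  refine ⟨Rat.HeightOneSpectrum.natGenerator u, Rat.HeightOneSpectrum.prime_natGenerator u, ?_,
    (W.dvd_conductorNorm_iff u).mpr hbadQ⟩
  have hmem : ((Rat.HeightOneSpectrum.natGenerator u : ℕ) : 𝓞 ℚ) ∈ u.asIdeal :=
    Rat.HeightOneSpectrum.natCast_natGenerator_mem u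
  rw [hu, HeightOneSpectrum.under_asIdeal, Ideal.under_def, Ideal.mem_comap, map_natCast] at hmem
  exact hmem

/-- **STUB F of line `birth` (skeleton v4), PROVED: the bad places of `E_K` prime to `3` over a Heegner
field are finitely many and split.** For `E = W/ℚ` of conductor `N` and an imaginary quadratic `K`
satisfying the Heegner hypothesis for `N`: the set of places `v ∤ 3` of `K` at which `W_K` has bad
reduction is finite (every such `v` contains `N ≠ 0`), and each lies over a rational prime `ℓ ∣ N`, which
has exactly two primes in `K`. [cite: GrossLMS1991, §1 (Heegner hypothesis: every prime dividing N splits in K)] [cite: SilvermanAEC2009, Prop. VII.5.4 (b)] -/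
theorem stub_badPlacesSplitFinite :
    ∀ (W : WeierstrassCurve ℚ) [W.IsElliptic] [W.IsGloballyMinimal] (N : ℕ) [NeZero N]
      (K : Type) [Field K] [NumberField K], W.conductorNorm ℤ = N →
      Literature.NumberTheory.EllipticCurves.IsImaginaryQuadratic K →
      Literature.NumberTheory.EllipticCurves.SatisfiesHeegnerHypothesis N K →
      {v : IsDedekindDomain.HeightOneSpectrum (NumberField.RingOfIntegers K) |
          ((3 : ℕ) : NumberField.RingOfIntegers K) ∉ v.asIdeal ∧ ¬ (W.baseChange K).HasGoodReductionAt v}.Finite ∧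
        ∀ v : IsDedekindDomain.HeightOneSpectrum (NumberField.RingOfIntegers K),
          ((3 : ℕ) : NumberField.RingOfIntegers K) ∉ v.asIdeal → ¬ (W.baseChange K).HasGoodReductionAt v →
          ((v.asIdeal.under ℤ).primesOver (NumberField.RingOfIntegers K)).ncard = 2 := by
  intro W _ _ N _ K _ _ hN _hK hHg
  refine ⟨?_, fun v _ hbad ↦ ?_⟩
  · refine (finite_setOf_natCast_mem (R := 𝓞 K) (ℓ := N) (NeZero.ne N)).subset ?_
    rintro v ⟨-, hbad⟩
    obtain ⟨ℓ, -, hℓv, hℓN⟩ := exists_prime_mem_dvd_conductorNorm_of_not_hasGoodReductionAt W K v hbad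
    rw [hN] at hℓN
    obtain ⟨m, hm⟩ := hℓN
    show ((N : ℕ) : 𝓞 K) ∈ v.asIdeal
    rw [hm, Nat.cast_mul]
    exact v.asIdeal.mul_mem_right _ hℓv
  · obtain ⟨ℓ, hℓ, hℓv, hℓN⟩ := exists_prime_mem_dvd_conductorNorm_of_not_hasGoodReductionAt W K v hbad
    rw [hN] at hℓN
    haveI : Fact ℓ.Prime := ⟨hℓ⟩
    have hover : v.asIdeal.under ℤ = Ideal.span {(ℓ : ℤ)} := (liesOver_span_int K ℓ v hℓv).over.symm
    rw [hover]
    exact hHg ℓ hℓ hℓN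

end Summit.BirchSwinnertonDyer.BirchSwinnertonDyer.Theorems.CumulativeHeegnerInclusionAtThreeBadPlaces

end
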